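import Mathlib.RingTheory.Valuation.ValuationSubring
import Mathlib.RingTheory.LocalRing.ResidueField.Basic
import Mathlib.FieldTheory.IntermediateField.Basic
import Mathlib.Analysis.Complex.Basic
import Mathlib.Algebra.GroupWithZero.WithZero
import Mathlib.LinearAlgebra.Dimension.Finrank
import Mathlib.Algebra.BigOperators.Finprod
import HarnessLib

/-!
# Roy–Waldschmidt 1997, §§3–4: places of a function field in one variable over `ℚ` and the height `𝐡₁`

D. Roy, M. Waldschmidt, Ann. Sci. ÉNS (4) 30 (1997) 753–796, §3 (Théorème 3.1, p. 763) and §4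
(pp. 772–773).  Vocabulary file (definitions with bodies and unfolding lemmas; no named facts,
nothing asserted) for the "function field" side of the proof of Théorème 5.1: `K ⊂ ℂ` is a subfield
of finite type and transcendence degree `1` over `ℚ`, "donc un corps de fonctions en une variable sur
`ℚ`" (p. 772).

* p. 763 (Théorème 3.1): "une place `𝔭` de `K` de degré `D` et un plongement de son corps résiduel
  `K̃` dans `ℂ` tels que les nombres `a₁, …, a_n` appartiennent à l'anneau de valuation `𝒪` de `𝔭` et
  que leurs images `ã₁, …, ã_n` sous l'homomorphisme de réduction `τ : 𝒪 → K̃` associé à `𝔭` …".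
* p. 772: "Étant donné un entier positif `n`, un point non nul `x = (x₀, x₁, …, x_n)` de `K^{n+1}` et
  une place non triviale `𝔮` de `K` sur `ℚ`, on définit l'ordre de `x` en `𝔮` par
  `ord_𝔮(x) = min{ord_𝔮(x₀), …, ord_𝔮(x_n)}`.  On définit aussi la hauteur du point projectif
  `(x₀ : x₁ : ⋯ : x_n) ∈ 𝐏ⁿ(K)` déterminé par `x` en posant `𝐡(x₀ : x₁ : ⋯ : x_n) = -∑_𝔮 ord_𝔮(x) deg(𝔮)`
  où la somme est étendue à toutes les places non triviales `𝔮` de `K` sur `ℚ`.  Enfin, on définit sur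
  `Kⁿ` une version affine de cette hauteur en posant `𝐡₁(x₁, …, x_n) = 𝐡(1 : x₁ : … : x_n)` pour
  tout `(x₁, …, x_n) ∈ Kⁿ`.  C'est simplement le degré du ppcm des diviseurs des pôles de
  `x₁, …, x_n`."

## The rendering

A (non-trivial) place of `K` over `ℚ` is an equivalence class of non-trivial valuations of `K`
trivial on `ℚ`; for a function field in one variable these are exactly the discrete valuations of
rank one, so we take as **data** the normalised discrete valuation `v_𝔮 : K → ℤᵐ⁰`
(`RoyWaldschmidt1997.Place`: a valuation with a uniformiser, i.e. `v_𝔮(π) = exp(-1)` for some `π`,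
and `v_𝔮(q) = 1` for `q ∈ ℚ^×`); two such valuations define the same place iff they are equal.
Then `𝒪_𝔮 = {x ; v_𝔮(x) ≤ 1}` (`Place.ring`, a `ValuationSubring`), `ord_𝔮(x) = -log v_𝔮(x) ∈ ℤ`
(`Place.ord`), the residue field `K̃ = 𝒪_𝔮/𝔪_𝔮` has characteristic `0` and
`deg(𝔮) = [K̃ : ℚ]` (`Place.deg`, `= 0` should `K̃/ℚ` be infinite), and
`𝐡₁(x₁, …, x_n) = ∑_𝔮 deg(𝔮) · max{0, -ord_𝔮(x₁), …, -ord_𝔮(x_n)} ∈ ℕ` (`ffHeight₁`, a `finsum`;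
that only finitely many places contribute is a theorem, not needed to state it).  "Un plongement
de son corps résiduel dans `ℂ`" composed with the reduction `𝒪_𝔮 → K̃` is a ring homomorphism
`τ : 𝒪_𝔮 →+* ℂ` whose kernel is the maximal ideal (`Place.IsReduction`).

## References

* [RoyWaldschmidt1997ENS] D. Roy, M. Waldschmidt, Ann. Sci. ÉNS (4) 30 (1997) 753–796, Théorème 3.1
  (p. 763), §4 (pp. 772–773), Lemme 4.2 (p. 773).
-/

noncomputable section

open scoped WithZero

namespace Literature.NumberTheory.Transcendental

namespace RoyWaldschmidt1997

variable {K : IntermediateField ℚ ℂ}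

/-- **A (non-trivial) place `𝔮` of `K` over `ℚ`**, given by its normalised discrete valuation
`v_𝔮 : K → ℤᵐ⁰` (multiplicative notation: `v_𝔮(x) = exp(-ord_𝔮(x))`): it takes the value `exp(-1)`
(there is a uniformiser) and is trivial on `ℚ^×`. [cite: RoyWaldschmidt1997ENS, §4, p. 772] -/
structure Place (K : IntermediateField ℚ ℂ) where
  /-- the normalised discrete valuation of the place -/
  val : Valuation K ℤᵐ⁰
  /-- normalisation: some element has valuation `exp(-1)` (order `1`) -/
  exists_uniformizer : ∃ π : K, val π = WithZero.exp (-1 : ℤ)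
  /-- the place is trivial on the constants `ℚ` -/
  val_ratCast : ∀ q : ℚ, q ≠ 0 → val (q : K) = 1

namespace Place

/-- The valuation ring `𝒪_𝔮 = {x ∈ K ; v_𝔮(x) ≤ 1}` of the place.
[cite: RoyWaldschmidt1997ENS, Théorème 3.1, p. 763] -/
def ring (p : Place K) : ValuationSubring K := p.val.valuationSubring

/-- Membership in `𝒪_𝔮`. [folklore] -/
theorem mem_ring_iff (p : Place K) (x : K) : x ∈ p.ring ↔ p.val x ≤ 1 :=
  Valuation.mem_valuationSubring_iff _ _

/-- The order `ord_𝔮(x) ∈ ℤ` of `x ∈ K` at the place (`v_𝔮(x) = exp(-ord_𝔮(x))`; junk value `0` at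
`x = 0`). [cite: RoyWaldschmidt1997ENS, §4, p. 772] -/
def ord (p : Place K) (x : K) : ℤ := -WithZero.log (p.val x)

/-- `v_𝔮(x) = exp(-ord_𝔮(x))` for `x ≠ 0`. [folklore] -/
theorem val_eq_exp_neg_ord (p : Place K) {x : K} (hx : x ≠ 0) : p.val x = WithZero.exp (-p.ord x) := by
  rw [ord, neg_neg, WithZero.exp_log ((Valuation.ne_zero_iff _).mpr hx)]

/-- `x ∈ 𝒪_𝔮 ↔ x = 0 ∨ ord_𝔮(x) ≥ 0`; for `x ≠ 0`: `x ∈ 𝒪_𝔮 ↔ 0 ≤ ord_𝔮(x)`. [folklore] -/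
theorem mem_ring_iff_ord (p : Place K) {x : K} (hx : x ≠ 0) : x ∈ p.ring ↔ 0 ≤ p.ord x := by
  rw [mem_ring_iff, val_eq_exp_neg_ord p hx, ← WithZero.exp_zero, WithZero.exp_le_exp]
  omega

/-- Rational constants lie in `𝒪_𝔮`. [folklore] -/
theorem ratCast_mem_ring (p : Place K) (q : ℚ) : (q : K) ∈ p.ring := by
  rw [mem_ring_iff]
  rcases eq_or_ne q 0 with rfl | hq
  · simp
  · rw [p.val_ratCast q hq]

/-- Natural number constants lie in `𝒪_𝔮`. [folklore] -/
theorem natCast_mem_ring (p : Place K) (n : ℕ) : (n : K) ∈ p.ring := by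
  have h := p.ratCast_mem_ring (n : ℚ)
  rwa [Rat.cast_natCast] at h

/-- The residue field `K̃ = 𝒪_𝔮/𝔪_𝔮` has characteristic zero (the place is trivial on `ℚ`).
[folklore] -/
instance charZero_residueField (p : Place K) : CharZero (IsLocalRing.ResidueField p.ring) := by
  refine ⟨fun m n hmn => ?_⟩
  -- `residue (m : 𝒪) = residue (n : 𝒪)` means `m - n ∈ 𝔪`, i.e. `v(m - n) < 1`; but it is `1` unless `m = n`.
  by_contra hne
  have hsub : ((m : K) - n) ≠ 0 := by
    intro h
    apply hne
    have : (m : ℂ) = n := by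
      have h' := congrArg (fun z : K => (z : ℂ)) h
      simp only [ZeroMemClass.coe_zero] at h'
      push_cast at h'
      linear_combination h'
    exact_mod_cast this
  have hq : p.val (((m : ℚ) - n : ℚ) : K) = 1 := p.val_ratCast _ (by
    intro h
    apply hne
    have : (m : ℚ) = n := by linarith
    exact_mod_cast this)
  have hy0 : (((m : ℚ) - n : ℚ) : K) ≠ 0 := by
    intro h; rw [h, Valuation.map_zero] at hq; exact zero_ne_one hq
  have hinv : (((m : ℚ) - n : ℚ) : K)⁻¹ ∈ p.ring := by
    rw [Place.mem_ring_iff, map_inv₀, hq, inv_one]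
  have hunit : IsUnit (⟨((m : ℚ) - n : ℚ), p.ratCast_mem_ring _⟩ : p.ring) :=
    IsUnit.of_mul_eq_one ⟨_, hinv⟩ (Subtype.ext (mul_inv_cancel₀ hy0))
  have hmem : (⟨((m : ℚ) - n : ℚ), p.ratCast_mem_ring _⟩ : p.ring) ∈ IsLocalRing.maximalIdeal p.ring := by
    rw [← IsLocalRing.residue_eq_zero_iff]
    have e : (⟨((m : ℚ) - n : ℚ), p.ratCast_mem_ring _⟩ : p.ring) = (m : p.ring) - (n : p.ring) := by
      apply Subtype.ext
      simp only [Rat.cast_sub, Rat.cast_natCast]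
      rfl
    rw [e, map_sub, map_natCast, map_natCast]
    exact sub_eq_zero.mpr hmn
  exact (IsLocalRing.mem_maximalIdeal _).mp hmem hunit

/-- **The degree** `deg(𝔮) = [K̃ : ℚ]` of the place (`K̃` its residue field; `0` if infinite).
[cite: RoyWaldschmidt1997ENS, §4, p. 772] -/
def deg (p : Place K) : ℕ := Module.finrank ℚ (IsLocalRing.ResidueField p.ring)

/-- "Un plongement de son corps résiduel `K̃` dans `ℂ`", composed with the reduction
`𝒪_𝔮 → K̃`: a ring homomorphism `τ : 𝒪_𝔮 → ℂ` whose kernel is the maximal ideal `𝔪_𝔮`.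
[cite: RoyWaldschmidt1997ENS, Théorème 3.1, p. 763] -/
def IsReduction (p : Place K) (τ : p.ring →+* ℂ) : Prop :=
  RingHom.ker τ = IsLocalRing.maximalIdeal p.ring

end Place

/-- **The affine height `𝐡₁(x₁, …, x_n) = 𝐡(1 : x₁ : ⋯ : x_n) = ∑_𝔮 deg(𝔮) max{0, -ord_𝔮(xᵢ)}`**
on `Kⁿ` — "le degré du ppcm des diviseurs des pôles de `x₁, …, x_n`" — as a `finsum` over all
places. [cite: RoyWaldschmidt1997ENS, §4, p. 772] -/
def ffHeight₁ {ι : Type*} [Fintype ι] (x : ι → K) : ℕ :=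
  ∑ᶠ q : Place K, q.deg * Finset.univ.sup fun i => (-(q.ord (x i))).toNat

/-- The local term of `𝐡₁` at a place: `deg(𝔮) · max{0, -ord_𝔮(x₁), …, -ord_𝔮(x_n)}`. [folklore] -/
theorem ffHeight₁_eq {ι : Type*} [Fintype ι] (x : ι → K) :
    ffHeight₁ x = ∑ᶠ q : Place K, q.deg * Finset.univ.sup fun i => (-(q.ord (x i))).toNat := rfl

/-- `𝐡₁` of a single element: `∑_𝔮 deg(𝔮) max{0, -ord_𝔮(x)}` (the degree of the divisor of poles).
[cite: RoyWaldschmidt1997ENS, §4, p. 773] -/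
theorem ffHeight₁_single (x : K) :
    ffHeight₁ (fun _ : Unit => x) = ∑ᶠ q : Place K, q.deg * (-(q.ord x)).toNat := by
  rw [ffHeight₁]
  congr 1
  funext q
  simp

end RoyWaldschmidt1997

end Literature.NumberTheory.Transcendental
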